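import Literature.MathematicalPhysics.QuantumLattice.TwoSpeciesCoordinates
import Literature.MathematicalPhysics.QuantumLattice.HubbardSzSectorLadder
import Literature.MathematicalPhysics.QuantumLattice.HubbardWave0LiebProofs
import Literature.MathematicalPhysics.QuantumLattice.LiebSpinReflection
import HarnessLib

/-!
# Route `LiebTwin`, crux `TwinOnsiteCondensation` (stmt-HubbardSuperconductivity-15258), line `majorant`:
# Lieb transfer of an opposite-spin pairing channel (helper, `--supports`)

For `φ` in Lieb's `(m+1, m+1)` sector and a one-body kernel `G`, the pair annihilator
`O_G = Σ_{x,y} G x y • c_{y↓} c_{x↑}` maps `φ` into the `(m, m)` sector, and in Lieb coordinates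
`liebW m (O_G φ) = (-1)^m • Φ_G`, `Φ_G = Σ_{x,y} G x y • (a_x W a_yᵀ)` with `W = liebW (m+1) φ` and
`a_x` the spinless annihilator between `(m+1)`- and `m`-subsets (`Matrix.submatrix` of `annihilation x`);
hence `⟨O_G φ, O_G φ⟩ = Σ_{γ,δ} |(Φ_G)_{γδ}|²` (`star_pairChannel_mulVec_dotProduct_eq`). Ingredients (all
in the tree): `TwoSpecies.coeffMatrix_annihilation_up/down_mulVec` (`c_{x↑} ↦ a_x·W`, `c_{y↓} ↦ P·W·a_yᵀ`),
the sector support of `W` (`TwoSpecies.isInSector_iff_coeffMatrix`), the sector ladder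
`IsInSector.annihilation_up/down_mulVec`, and unitarity `LiebThm1.hsInner_liebW`.

Sources: E. H. Lieb, PRL **62** (1989) 1201, proof of Theorem 1, eqs. (3)–(4); H. Tasaki, *Physics and
Mathematics of Quantum Many-Body Systems* (2020) §9.2.1. Everything is bookkeeping; no definition and no
named fact is introduced.
-/

-- the mandated namespace `Summit.<Summit>.<Problem>.Theorems` repeats `HubbardSuperconductivity`
-- (single-problem summit, D-0017), which the `dupNamespace` linter flags on every declaration
set_option linter.dupNamespace false

noncomputable section

namespace Summit.HubbardSuperconductivity.HubbardSuperconductivity.Theorems.LiebTwinMajorant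

open Matrix Finset Literature.MathematicalPhysics.QuantumLattice
open scoped ComplexOrder

section Transfer

variable {Λ : Type*} [LinearOrder Λ] [Fintype Λ]

/-- Sectors are closed under finite sums. [folklore] -/
theorem isInSector_sum {ι : Type*} {a b : ℕ} (S : Finset ι) {f : ι → Fock (Orb Λ)}
    (hf : ∀ i ∈ S, IsInSector a b (f i)) : IsInSector a b (∑ i ∈ S, f i) :=
  Finset.sum_induction f (IsInSector a b) (fun _ _ => IsInSector.add) (IsInSector.zero a b) hf

/-- `O_G φ = Σ_{x,y} G x y • c_{y↓} (c_{x↑} φ)` for `O_G = Σ_{x,y} G x y • c_{y↓} c_{x↑}`. [folklore] -/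
theorem pairChannel_mulVec_eq (G : Matrix Λ Λ ℂ) (φ : Fock (Orb Λ)) :
    (∑ x : Λ, ∑ y : Λ, G x y • (annihilation (orb y 1) * annihilation (orb x 0) :
        Matrix (Finset (Orb Λ)) (Finset (Orb Λ)) ℂ)) *ᵥ φ =
      ∑ x : Λ, ∑ y : Λ, G x y • (annihilation (orb y 1) *ᵥ (annihilation (orb x 0) *ᵥ φ)) := by
  rw [Matrix.sum_mulVec]
  refine Finset.sum_congr rfl fun x _ => ?_
  rw [Matrix.sum_mulVec]
  refine Finset.sum_congr rfl fun y _ => ?_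
  rw [Matrix.smul_mulVec, Matrix.mulVec_mulVec]

/-- **The pair annihilator lowers the sector**: `O_G` maps `(m+1, m+1)` into `(m, m)`.
Lieb, PRL 62 (1989) 1201, eq. (2). [folklore] -/
theorem isInSector_pairChannel_mulVec {m : ℕ} {φ : Fock (Orb Λ)} (hφ : IsInSector (m + 1) (m + 1) φ)
    (G : Matrix Λ Λ ℂ) :
    IsInSector m m ((∑ x : Λ, ∑ y : Λ, G x y • (annihilation (orb y 1) * annihilation (orb x 0) :
        Matrix (Finset (Orb Λ)) (Finset (Orb Λ)) ℂ)) *ᵥ φ) := by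
  rw [pairChannel_mulVec_eq]
  refine isInSector_sum _ fun x _ => isInSector_sum _ fun y _ => IsInSector.smul ?_ _
  exact (hφ.annihilation_up_mulVec x).annihilation_down_mulVec y

/-- **Coefficient matrix of `O_G φ`**: `W(O_G φ) = P · Σ_{x,y} G x y • (a_x W(φ) a_yᵀ)` on all pairs of
subsets (`P` the up-parity, `a_x` the spinless annihilator). Lieb, PRL 62 (1989) 1201, proof of Theorem 1;
Tasaki (2020) §9.2.1. [folklore] -/
theorem coeffMatrix_pairChannel_mulVec (G : Matrix Λ Λ ℂ) (φ : Fock (Orb Λ)) :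
    TwoSpecies.coeffMatrix ((∑ x : Λ, ∑ y : Λ, G x y • (annihilation (orb y 1) * annihilation (orb x 0) :
        Matrix (Finset (Orb Λ)) (Finset (Orb Λ)) ℂ)) *ᵥ φ) =
      TwoSpecies.upParity * ∑ x : Λ, ∑ y : Λ,
        G x y • (annihilation x * TwoSpecies.coeffMatrix φ * (annihilation y)ᵀ) := by
  rw [pairChannel_mulVec_eq, TwoSpecies.coeffMatrix_sum, Finset.mul_sum]
  refine Finset.sum_congr rfl fun x _ => ?_
  rw [TwoSpecies.coeffMatrix_sum, Finset.mul_sum]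
  refine Finset.sum_congr rfl fun y _ => ?_
  rw [TwoSpecies.coeffMatrix_smul, TwoSpecies.coeffMatrix_annihilation_down_mulVec,
    TwoSpecies.coeffMatrix_annihilation_up_mulVec, Matrix.mul_smul, Matrix.mul_assoc, Matrix.mul_assoc]

/-- Restriction of `a_x W(φ) a_yᵀ` to `m`-subsets for `φ` in the `(m+1, m+1)` sector: the intermediate
sums run over `(m+1)`-subsets only (sector support of `W(φ)`), i.e. the entry equals that of the product of
the rectangular config operators with `liebW (m+1) φ`. Lieb, PRL 62 (1989) 1201, proof of Theorem 1. [folklore] -/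
theorem annihilation_mul_coeffMatrix_mul_apply {m : ℕ} {φ : Fock (Orb Λ)} (hφ : IsInSector (m + 1) (m + 1) φ)
    (x y : Λ) (γ δ : Config Λ m) :
    (annihilation x * TwoSpecies.coeffMatrix φ * (annihilation y)ᵀ) γ.1 δ.1 =
      ((annihilation x).submatrix (Subtype.val : Config Λ m → Finset Λ) (Subtype.val : Config Λ (m + 1) → Finset Λ) *
          liebW (m + 1) φ *
        ((annihilation y).submatrix (Subtype.val : Config Λ m → Finset Λ)
          (Subtype.val : Config Λ (m + 1) → Finset Λ))ᵀ) γ δ := by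
  have hsupp := (TwoSpecies.isInSector_iff_coeffMatrix (m + 1) (m + 1) φ).1 hφ
  simp only [Matrix.mul_apply, transpose_apply, submatrix_apply]
  symm
  -- the inner sums over `(m+1)`-subsets are the full sums (sector support of `W(φ)`)
  have e1 : ∀ τ : Config Λ (m + 1),
      ∑ σ : Config Λ (m + 1), annihilation x γ.1 σ.1 * liebW (m + 1) φ σ τ =
        ∑ s : Finset Λ, annihilation x γ.1 s * TwoSpecies.coeffMatrix φ s τ.1 := fun τ =>
    sum_config_eq_sum (m + 1) (fun s => annihilation x γ.1 s * TwoSpecies.coeffMatrix φ s τ.1)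
      fun s hs => by rw [hsupp s τ.1 (fun h => hs h.1), mul_zero]
  simp_rw [e1]
  refine sum_config_eq_sum (m + 1)
    (fun t => (∑ s : Finset Λ, annihilation x γ.1 s * TwoSpecies.coeffMatrix φ s t) * annihilation y δ.1 t)
    fun t ht => ?_
  rw [Finset.sum_eq_zero fun s _ => ?_, zero_mul]
  rw [hsupp s t (fun h => ht h.2), mul_zero]

/-- **`O_G` in Lieb coordinates**: `liebW m (O_G φ) = (-1)^m • Φ_G` with
`Φ_G = Σ_{x,y} G x y • (a_x W a_yᵀ)`, `W = liebW (m+1) φ`, `a_x` the spinless annihilator from `(m+1)`- to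
`m`-subsets (the up-parity is `(-1)^m` on `m`-subsets). Lieb, PRL 62 (1989) 1201, proof of Theorem 1,
eqs. (3)–(4); Tasaki (2020) §9.2.1. [folklore] -/
theorem liebW_pairChannel_mulVec {m : ℕ} {φ : Fock (Orb Λ)} (hφ : IsInSector (m + 1) (m + 1) φ)
    (G : Matrix Λ Λ ℂ) :
    liebW m ((∑ x : Λ, ∑ y : Λ, G x y • (annihilation (orb y 1) * annihilation (orb x 0) :
        Matrix (Finset (Orb Λ)) (Finset (Orb Λ)) ℂ)) *ᵥ φ) =
      ((-1 : ℂ) ^ m) • ∑ x : Λ, ∑ y : Λ, G x y •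
        ((annihilation x).submatrix (Subtype.val : Config Λ m → Finset Λ) (Subtype.val : Config Λ (m + 1) → Finset Λ) *
            liebW (m + 1) φ *
          ((annihilation y).submatrix (Subtype.val : Config Λ m → Finset Λ)
            (Subtype.val : Config Λ (m + 1) → Finset Λ))ᵀ) := by
  ext γ δ
  change TwoSpecies.coeffMatrix _ γ.1 δ.1 = _
  rw [coeffMatrix_pairChannel_mulVec, TwoSpecies.upParity, diagonal_mul, γ.2, Matrix.smul_apply, smul_eq_mul]
  congr 1
  simp only [Matrix.sum_apply, Matrix.smul_apply, smul_eq_mul]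
  refine Finset.sum_congr rfl fun x _ => Finset.sum_congr rfl fun y _ => ?_
  rw [annihilation_mul_coeffMatrix_mul_apply hφ]

/-- **The pairing channel in Lieb coordinates (norm identity).** For `φ` in the `(m+1, m+1)` sector:
`⟨O_G φ, O_G φ⟩ = Σ_{γ,δ} |(Φ_G)_{γδ}|²`, `Φ_G = Σ_{x,y} G x y • (a_x W a_yᵀ)` (`ψ ↦ W(ψ)` is unitary on the
`(m, m)` sector). Lieb, PRL 62 (1989) 1201, proof of Theorem 1. [folklore] -/
theorem star_pairChannel_mulVec_dotProduct_eq {m : ℕ} {φ : Fock (Orb Λ)} (hφ : IsInSector (m + 1) (m + 1) φ)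
    (G : Matrix Λ Λ ℂ) :
    star ((∑ x : Λ, ∑ y : Λ, G x y • (annihilation (orb y 1) * annihilation (orb x 0) :
        Matrix (Finset (Orb Λ)) (Finset (Orb Λ)) ℂ)) *ᵥ φ) ⬝ᵥ
        ((∑ x : Λ, ∑ y : Λ, G x y • (annihilation (orb y 1) * annihilation (orb x 0) :
          Matrix (Finset (Orb Λ)) (Finset (Orb Λ)) ℂ)) *ᵥ φ) =
      ((∑ γ : Config Λ m, ∑ δ : Config Λ m, ‖(∑ x : Λ, ∑ y : Λ, G x y •
        ((annihilation x).submatrix (Subtype.val : Config Λ m → Finset Λ) (Subtype.val : Config Λ (m + 1) → Finset Λ) *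
            liebW (m + 1) φ *
          ((annihilation y).submatrix (Subtype.val : Config Λ m → Finset Λ)
            (Subtype.val : Config Λ (m + 1) → Finset Λ))ᵀ)) γ δ‖ ^ 2 : ℝ) : ℂ) := by
  rw [← LiebThm1.hsInner_liebW (isInSector_pairChannel_mulVec hφ G), hsInner_self_eq,
    liebW_pairChannel_mulVec hφ G]
  congr 1
  refine Finset.sum_congr rfl fun γ _ => Finset.sum_congr rfl fun δ _ => ?_
  rw [Matrix.smul_apply, smul_eq_mul, norm_mul, norm_pow, norm_neg, norm_one, one_pow, one_mul]

end Transfer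

/-- **Expectation form (Lieb transfer of a pairing channel).** For `φ` in the `(m+1, m+1)` sector and any
kernel `G`: `⟨φ, O_Gᴴ O_G φ⟩ = Σ_{γ,δ} |(Φ_G)_{γδ}|²`, `O_G = Σ_{x,y} G x y • c_{y↓} c_{x↑}`,
`Φ_G = Σ_{x,y} G x y • (a_x W a_yᵀ)`, `W = liebW (m+1) φ`. Lieb, PRL 62 (1989) 1201, proof of Theorem 1,
eqs. (3)–(4). [folklore] -/
theorem expect_pairChannel_eq :
    ∀ {Λ : Type*} [LinearOrder Λ] [Fintype Λ] {m : ℕ} {φ : Fock (Orb Λ)}, IsInSector (m + 1) (m + 1) φ →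
      ∀ G : Matrix Λ Λ ℂ,
        expect ((∑ x : Λ, ∑ y : Λ, G x y • (annihilation (orb y 1) * annihilation (orb x 0) :
            Matrix (Finset (Orb Λ)) (Finset (Orb Λ)) ℂ))ᴴ *
            (∑ x : Λ, ∑ y : Λ, G x y • (annihilation (orb y 1) * annihilation (orb x 0)))) φ =
          ((∑ γ : Config Λ m, ∑ δ : Config Λ m, ‖(∑ x : Λ, ∑ y : Λ, G x y •
            ((annihilation x).submatrix (Subtype.val : Config Λ m → Finset Λ)
                  (Subtype.val : Config Λ (m + 1) → Finset Λ) *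
                liebW (m + 1) φ *
              ((annihilation y).submatrix (Subtype.val : Config Λ m → Finset Λ)
                (Subtype.val : Config Λ (m + 1) → Finset Λ))ᵀ)) γ δ‖ ^ 2 : ℝ) : ℂ) := by
  intro Λ _ _ m φ hφ G
  rw [Literature.MathematicalPhysics.QuantumLattice.expect, LiebThm1.star_dotProduct_conjTranspose_mul_mulVec,
    star_pairChannel_mulVec_dotProduct_eq hφ]

end Summit.HubbardSuperconductivity.HubbardSuperconductivity.Theorems.LiebTwinMajorant

end
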